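import Summits.Ventures.QEC.Census.CNFEncodeXor
import HarnessLib

/-!
# `enc-v1` encoder: completeness of the Sinz sequential counter block

Cell `qec`, PARTITION v2 row type-11; block (3) of `cnfEncode`: an assignment of weight `≤ w` on the
coordinates extends by `s_{i,j} := [x_1 + ⋯ + x_i ≥ j]` (`counterModel`) to a model of `atMost N w nv`
[Sinz, CP 2005, LNCS 3709, `LT_SEQ`], and the block's variables lie below `nv + (N-1)·w`.
-/

namespace Summit.Ventures.QEC.Census.CNFEncode

open Std.Sat

section Semantics

variable (a : ℕ → Bool)

/-! ### The sequential counter -/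

/-- One more coordinate adds its bit to the partial count. -/
theorem pcount_succ (i : ℕ) : pcount a (i + 1) = pcount a i + (if a i then 1 else 0) := by
  simp [pcount, List.range_succ, List.countP_append]

/-- Partial counts are monotone. -/
theorem pcount_mono {i j : ℕ} (h : i ≤ j) : pcount a i ≤ pcount a j := by
  induction h with
  | refl => exact le_rfl
  | step _ ih => rw [pcount_succ]; split <;> omega

/-- The full count is the weight. -/
theorem pcount_eq_weight (n : ℕ) : pcount a n = weight a n := rfl

/-- The counter model does not touch variables below the block. -/
theorem counterModel_old (N w nv : ℕ) (y : ℕ) (hy : y < nv) : counterModel a N w nv y = a y := by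
  simp only [counterModel]; rw [if_neg (by omega)]

/-- Value of the counter model at `s_{i,j}`: `[j ≤ x_1 + ⋯ + x_i]`. -/
theorem counterModel_svar (N w nv i j : ℕ) (hw : 0 < w) (hi : 1 ≤ i) (hi' : i ≤ N - 1) (hj : 1 ≤ j)
    (hj' : j ≤ w) : counterModel a N w nv (svar w nv i j) = decide (j ≤ pcount a i) := by
  simp only [counterModel, svar]
  have hlt : (i - 1) * w + (j - 1) < (N - 1) * w := by
    calc (i - 1) * w + (j - 1) < (i - 1) * w + w := by omega
      _ = (i - 1 + 1) * w := by rw [Nat.add_mul, Nat.one_mul]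
      _ ≤ (N - 1) * w := Nat.mul_le_mul_right _ (by omega)
  rw [if_pos (by omega)]
  have h1 : nv + (i - 1) * w + (j - 1) - nv = (i - 1) * w + (j - 1) := by omega
  have h2 : ((i - 1) * w + (j - 1)) % w = j - 1 := by
    rw [Nat.mul_comm, Nat.mul_add_mod]; exact Nat.mod_eq_of_lt (by omega)
  have h3 : ((i - 1) * w + (j - 1)) / w = i - 1 := by
    rw [Nat.mul_comm, Nat.mul_add_div hw, Nat.div_eq_of_lt (by omega)]; simp
  have h4 : j - 1 + 1 = j := by omega
  have h5 : i - 1 + 1 = i := by omega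
  simp only [h1, h2, h3, h4, h5]

/-- The sequential-counter block is complete: an assignment of weight `≤ w` on the coordinates
`0 … N-1` (all `< nv`) extends to a model, changing only variables `≥ nv`. -/
theorem atMost_sound (N w nv : ℕ) (hN : N ≤ nv) (hwt : weight a N ≤ w) :
    ∃ a' : ℕ → Bool, (∀ y < nv, a' y = a y) ∧ ∀ c ∈ atMost N w nv, CNF.Clause.eval a' c = true := by
  unfold atMost
  split
  · exact ⟨a, fun _ _ => rfl, by simp⟩
  split
  · -- `w = 0`: every coordinate is `false`
    subst_vars
    refine ⟨a, fun _ _ => rfl, ?_⟩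
    intro c hc
    simp only [List.mem_map, List.mem_range] at hc
    obtain ⟨i, hi, rfl⟩ := hc
    have hpi : pcount a (i + 1) ≤ 0 :=
      le_trans (pcount_mono a (Nat.succ_le_of_lt hi)) (by simpa [pcount_eq_weight] using hwt)
    rw [pcount_succ] at hpi
    have : a i = false := by revert hpi; cases a i <;> simp
    simp [CNF.Clause.eval, this]
  · rename_i hNw hw0
    have hw : 0 < w := Nat.pos_of_ne_zero hw0
    have hNw' : w < N := Nat.lt_of_not_le hNw
    refine ⟨counterModel a N w nv, fun y hy => counterModel_old a N w nv y hy, ?_⟩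
    -- facts about the model
    have hx : ∀ k, k < N → counterModel a N w nv k = a k :=
      fun k hk => counterModel_old a N w nv k (lt_of_lt_of_le hk hN)
    have hs : ∀ i j, 1 ≤ i → i ≤ N - 1 → 1 ≤ j → j ≤ w →
        counterModel a N w nv (svar w nv i j) = decide (j ≤ pcount a i) :=
      fun i j hi hi' hj hj' => counterModel_svar a N w nv i j hw hi hi' hj hj'
    have htot : ∀ i, i ≤ N → pcount a i ≤ w :=
      fun i hi => le_trans (pcount_mono a hi) (by simpa [pcount_eq_weight] using hwt)
    have hstep : ∀ i, pcount a (i + 1) = pcount a i + (if a i then 1 else 0) := pcount_succ a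
    intro c hc
    simp only [List.mem_append, List.mem_cons, List.mem_map, List.mem_flatMap, List.mem_range'_1,
      List.not_mem_nil, or_false] at hc
    -- eight clause shapes
    rcases hc with ((rfl | ⟨j, ⟨hj, hj'⟩, rfl⟩) | ⟨i, ⟨hi, hi'⟩, hc⟩) | rfl
    · -- (¬x₁ ∨ s₁₁)
      simp only [CNF.Clause.eval_cons, CNF.Clause.eval_nil, Bool.or_false, Bool.or_eq_true,
        beq_iff_eq]
      rw [hx 0 (by omega), hs 1 1 le_rfl (by omega) le_rfl hw]
      have := hstep 0
      simp only [pcount, List.range_zero, List.countP_nil, zero_add] at this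
      cases h0 : a 0
      · simp
      · right; rw [decide_eq_true_eq]; simp [pcount, List.range_one, h0]
    · -- (¬s₁ⱼ), 1 < j ≤ w
      simp only [CNF.Clause.eval_cons, CNF.Clause.eval_nil, Bool.or_false, beq_iff_eq]
      rw [hs 1 j le_rfl (by omega) (by omega) (by omega), decide_eq_false_iff_not]
      have : pcount a 1 ≤ 1 := by
        rw [hstep 0]; simp only [pcount, List.range_zero, List.countP_nil]; split <;> omega
      omega
    · -- the clauses for 1 < i < N
      rcases hc with ((rfl | rfl) | ⟨j, ⟨hj, hj'⟩, (rfl | rfl)⟩) | rfl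
      · -- (¬xᵢ ∨ sᵢ₁)
        simp only [CNF.Clause.eval_cons, CNF.Clause.eval_nil, Bool.or_false, Bool.or_eq_true,
          beq_iff_eq]
        rw [hx (i - 1) (by omega), hs i 1 (by omega) (by omega) le_rfl hw]
        cases h0 : a (i - 1)
        · simp
        · right; rw [decide_eq_true_eq]
          have := hstep (i - 1)
          rw [show i - 1 + 1 = i by omega, h0] at this
          simp only [ite_true] at this; omega
      · -- (¬sᵢ₋₁,₁ ∨ sᵢ₁)
        simp only [CNF.Clause.eval_cons, CNF.Clause.eval_nil, Bool.or_false, Bool.or_eq_true,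
          beq_iff_eq]
        rw [hs (i - 1) 1 (by omega) (by omega) le_rfl hw, hs i 1 (by omega) (by omega) le_rfl hw]
        by_cases h0 : 1 ≤ pcount a (i - 1)
        · right; rw [decide_eq_true_eq]; exact le_trans h0 (pcount_mono a (by omega))
        · left; rw [decide_eq_false_iff_not]; exact h0
      · -- (¬xᵢ ∨ ¬sᵢ₋₁,ⱼ₋₁ ∨ sᵢⱼ)
        simp only [CNF.Clause.eval_cons, CNF.Clause.eval_nil, Bool.or_false, Bool.or_eq_true,
          beq_iff_eq]
        rw [hx (i - 1) (by omega), hs (i - 1) (j - 1) (by omega) (by omega) (by omega) (by omega),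
          hs i j (by omega) (by omega) (by omega) (by omega)]
        cases h0 : a (i - 1)
        · simp
        · right
          by_cases h1 : j - 1 ≤ pcount a (i - 1)
          · right; rw [decide_eq_true_eq]
            have := hstep (i - 1)
            rw [show i - 1 + 1 = i by omega, h0] at this
            simp only [ite_true] at this; omega
          · left; rw [decide_eq_false_iff_not]; exact h1
      · -- (¬sᵢ₋₁,ⱼ ∨ sᵢⱼ)
        simp only [CNF.Clause.eval_cons, CNF.Clause.eval_nil, Bool.or_false, Bool.or_eq_true,
          beq_iff_eq]
        rw [hs (i - 1) j (by omega) (by omega) (by omega) (by omega), hs i j (by omega) (by omega) (by omega) (by omega)]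
        by_cases h0 : j ≤ pcount a (i - 1)
        · right; rw [decide_eq_true_eq]; exact le_trans h0 (pcount_mono a (by omega))
        · left; rw [decide_eq_false_iff_not]; exact h0
      · -- (¬xᵢ ∨ ¬sᵢ₋₁,w)
        simp only [CNF.Clause.eval_cons, CNF.Clause.eval_nil, Bool.or_false, Bool.or_eq_true,
          beq_iff_eq]
        rw [hx (i - 1) (by omega), hs (i - 1) w (by omega) (by omega) hw le_rfl]
        cases h0 : a (i - 1)
        · simp
        · right; rw [decide_eq_false_iff_not]
          intro hle
          have := hstep (i - 1)
          rw [show i - 1 + 1 = i by omega, h0] at this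
          simp only [ite_true] at this
          have := htot i (by omega)
          omega
    · -- (¬x_N ∨ ¬s_{N-1,w})
      simp only [CNF.Clause.eval_cons, CNF.Clause.eval_nil, Bool.or_false, Bool.or_eq_true,
        beq_iff_eq]
      rw [hx (N - 1) (by omega), hs (N - 1) w (by omega) le_rfl hw le_rfl]
      cases h0 : a (N - 1)
      · simp
      · right; rw [decide_eq_false_iff_not]
        intro hle
        have := hstep (N - 1)
        rw [show N - 1 + 1 = N by omega, h0] at this
        simp only [ite_true] at this
        have := htot N le_rfl
        omega

/-- Variables of the counter block lie below `nv + (N-1)·w` (given the coordinates are `< nv`). -/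
theorem atMost_vars (N w nv : ℕ) (hN : N ≤ nv) :
    ∀ c ∈ atMost N w nv, ∀ l ∈ c, l.1 < nv + (N - 1) * w := by
  intro c hc l hl
  unfold atMost at hc
  have hsv : ∀ i j, 1 ≤ i → i ≤ N - 1 → 1 ≤ j → j ≤ w → 0 < w → svar w nv i j < nv + (N - 1) * w := by
    intro i j hi hi' hj hj' hw
    simp only [svar]
    calc nv + (i - 1) * w + (j - 1) < nv + ((i - 1) * w + w) := by omega
      _ = nv + (i - 1 + 1) * w := by rw [Nat.add_mul, Nat.one_mul]
      _ ≤ nv + (N - 1) * w := by apply Nat.add_le_add_left; exact Nat.mul_le_mul_right _ (by omega)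
  split at hc
  · simp at hc
  split at hc
  · simp only [List.mem_map, List.mem_range] at hc
    obtain ⟨i, hi, rfl⟩ := hc
    simp only [List.mem_singleton] at hl
    subst hl; simp only; omega
  · rename_i hNw hw0
    have hw : 0 < w := Nat.pos_of_ne_zero hw0
    have hNw' : w < N := Nat.lt_of_not_le hNw
    simp only [List.mem_append, List.mem_cons, List.mem_map, List.mem_flatMap, List.mem_range'_1,
      List.not_mem_nil, or_false] at hc
    rcases hc with ((rfl | ⟨j, ⟨hj, hj'⟩, rfl⟩) | ⟨i, ⟨hi, hi'⟩, hc⟩) | rfl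
    · simp only [List.mem_cons, List.not_mem_nil, or_false] at hl
      rcases hl with rfl | rfl
      · simp only; have := Nat.zero_le ((N - 1) * w); omega
      · exact hsv 1 1 le_rfl (by omega) le_rfl hw hw
    · simp only [List.mem_cons, List.not_mem_nil, or_false] at hl
      subst hl; exact hsv 1 j le_rfl (by omega) (by omega) (by omega) hw
    · rcases hc with ((rfl | rfl) | ⟨j, ⟨hj, hj'⟩, (rfl | rfl)⟩) | rfl <;>
        simp only [List.mem_cons, List.not_mem_nil, or_false] at hl
      · rcases hl with rfl | rfl
        · simp only; have := Nat.zero_le ((N - 1) * w); omega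
        · exact hsv i 1 (by omega) (by omega) le_rfl hw hw
      · rcases hl with rfl | rfl
        · exact hsv (i - 1) 1 (by omega) (by omega) le_rfl hw hw
        · exact hsv i 1 (by omega) (by omega) le_rfl hw hw
      · rcases hl with rfl | rfl | rfl
        · simp only; have := Nat.zero_le ((N - 1) * w); omega
        · exact hsv (i - 1) (j - 1) (by omega) (by omega) (by omega) (by omega) hw
        · exact hsv i j (by omega) (by omega) (by omega) (by omega) hw
      · rcases hl with rfl | rfl
        · exact hsv (i - 1) j (by omega) (by omega) (by omega) (by omega) hw
        · exact hsv i j (by omega) (by omega) (by omega) (by omega) hw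
      · rcases hl with rfl | rfl
        · simp only; have := Nat.zero_le ((N - 1) * w); omega
        · exact hsv (i - 1) w (by omega) (by omega) hw le_rfl hw
    · simp only [List.mem_cons, List.not_mem_nil, or_false] at hl
      rcases hl with rfl | rfl
      · simp only; have := Nat.zero_le ((N - 1) * w); omega
      · exact hsv (N - 1) w (by omega) le_rfl hw le_rfl hw

end Semantics

end Summit.Ventures.QEC.Census.CNFEncode
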